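import Summits.CriticalPhenomena.PercolationContinuityZ3.Theorems.PercNearOneGluingNoHeavyQuantThreeRelaySiblings
import HarnessLib

/-!
# QUANT lane R8, T-DEC: SIBLINGS WHOSE ONLY POSITIVE LOW ATOM IS `1` — the closed-form hull + high certificate for every top `M ≥ 3`
# (three inequalities C1, C3, C4; for `M = 3` it is `hullHigh_three`), i.e. for every gated sibling with `2 < q·E[count] ≤ 4`

builds on p205010 (kernel theorem, internal audit signed; external expert review pending)

Support file (`--supports stmt-CriticalPhenomena-4575`), QUANT lane seat prim-quant-census-1 (gen 29); memo
`run/shared/lean/prim/quant/prim-quant-census-1/g29/HULLHIGH-G29.md` §5 (the template read off the LP certificates of kit j280672: big blob + `[(M−1,g₁),(1,g₂)]`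
+ HIGH part).  Theorems only, standard axioms, no sorries.  Over census-1 g29's `…QuantHullHigh` / `…QuantThreeRelaySiblings` (`IsHigh`, `HullHigh`,
`HullHigh.mix₃`, `hullHigh_blobLaw`, `hullHigh_of_isHigh`).

THE CERTIFICATE.  `ν` a probability law on `{0..M}` (`M ≥ 3`) with mean `m < M` whose charged atoms `h ≥ 2` satisfy `m ≤ 2h` (automatic when `m ≤ 4`): the only
possible positive low atom is `1`.  With `A = blobLaw[(M, m/M)]`, `Z = blobLaw[(M−1, g₁), (1, g₂)]` (`(M−1)g₁ + g₂ = m`; law `((1−g₁)(1−g₂), (1−g₁)g₂ at 1,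
g₁(1−g₂) at M−1, g₁g₂ at M)`), `z = ν(1)/(g₂(1−g₁))`, `a = (ν(0) − z(1−g₁)(1−g₂))/(1 − m/M)`, the remainder `R = ν − a·A − z·Z` vanishes at `0, 1` and is a high law
after normalisation iff it is nonnegative at `M−1` and `M`:
  **C1** `ν(1)(1−g₂) ≤ ν(0)·g₂`,  **C3** `ν(1)·g₁(1−g₂) ≤ ν(M−1)·g₂(1−g₁)`,  **C4** `(ν(0)g₂(1−g₁) − ν(1)(1−g₁)(1−g₂))·m + ν(1)g₁g₂(M − m) ≤ ν(M)(M − m)g₂(1−g₁)`.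
* **`hullHigh_lowOne`** — C1 ∧ C3 ∧ C4 (gates `x ≤ g₂ ≤ 1`, `0 < g₂`, `x ≤ g₁ < 1`) ⟹
  `HullHigh x m M ν`; **`hullHigh_gate_lowOne`** — the sibling form (`gate s.ρ s.q`, `s.q·s.mean ≤ 4`; for `s.q·s.mean ≤ 2` use the simpler `hullHigh_gate_of_meanTwo`).  For `M = 3`, C4 ⟺ C3 (`…ThreeRelaySiblings`);
  for `M ≥ 4` the three conditions are independent (3-leaf stars, brooms, 4-chains: census 100 % / 99.8 % / 99.3 % hull+high at the true floor, kit j282159).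

HONEST STATUS.  Sufficient criterion; `SiblingStep` ⟺ `GateStepN`, `UPartStep`, `LightResidDECOracle`, `FarTreeRow` OPEN; RATE class (log\*) / honest sentence of
`run/shared/lean/prim/quant/README.md` unchanged.  [this work].  Nothing here is cited as a published result.  The gluing rows served
[cite: KozmaNitzan2024, Conjecture 3 (p. 15)]; product measure [cite: Grimmett1999, §1.3 p. 10].
-/

noncomputable section

open scoped BigOperators

namespace Summit.CriticalPhenomena.PercolationContinuityZ3.Theorems
namespace Quant
namespace LawDec

open Finset

/-- **THE HULL + HIGH CERTIFICATE FOR LAWS WHOSE ONLY POSITIVE LOW ATOM IS `1`.**  `ν` a probability law on `{0..M}`, `M ≥ 3`, mean `0 < m < M`, every charged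
atom `h ≥ 2` with `m ≤ 2h`; gates `0 < g₂ ≤ 1`, `x ≤ g₂`, `x ≤ g₁ < 1` with `(M−1)g₁ + g₂ = m`; C1, C3, C4 (module docstring) ⟹ `HullHigh x m M ν`. [this work] -/
theorem hullHigh_lowOne (x m g₁ g₂ : ℝ) (M : ℕ) (hM : 3 ≤ M) (ν : ℕ → ℝ) (hν0 : ∀ h, 0 ≤ ν h) (hνM : ∀ h, M < h → ν h = 0)
    (hν1 : ∑ h ∈ Finset.range (M + 1), ν h = 1) (hmean : ∑ h ∈ Finset.range (M + 1), (h : ℝ) * ν h = m) (hmM : m < M)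
    (hhigh2 : ∀ h, 0 < ν h → 2 ≤ h → m ≤ 2 * (h : ℝ)) (hg : ((M : ℝ) - 1) * g₁ + g₂ = m)
    (hxg₂ : x ≤ g₂) (hg₂0 : 0 < g₂) (hg₂1 : g₂ ≤ 1) (hxg₁ : x ≤ g₁) (hg₁1 : g₁ < 1)
    (C1 : ν 1 * (1 - g₂) ≤ ν 0 * g₂) (C3 : ν 1 * g₁ * (1 - g₂) ≤ ν (M - 1) * g₂ * (1 - g₁))
    (C4 : (ν 0 * g₂ * (1 - g₁) - ν 1 * (1 - g₁) * (1 - g₂)) * m + ν 1 * g₁ * g₂ * ((M : ℝ) - m) ≤ ν M * ((M : ℝ) - m) * g₂ * (1 - g₁)) :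
    HullHigh x m M ν := by
  have hMpos : (0 : ℝ) < M := by exact_mod_cast (show 0 < M by omega)
  have hM3 : (3 : ℝ) ≤ M := by exact_mod_cast hM
  have hcast : (((M - 1 : ℕ) : ℝ)) = (M : ℝ) - 1 := by
    rw [Nat.cast_sub (by omega : 1 ≤ M)]; simp
  have hxM : x * (M : ℝ) ≤ m := by
    have : x * ((M : ℝ) - 1) ≤ g₁ * ((M : ℝ) - 1) := mul_le_mul_of_nonneg_right hxg₁ (by linarith)
    linarith
  -- the weights
  have hden : 0 < g₂ * (1 - g₁) := mul_pos hg₂0 (by linarith)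
  set z : ℝ := ν 1 / (g₂ * (1 - g₁)) with hz
  have hz0 : 0 ≤ z := div_nonneg (hν0 1) hden.le
  have hzid : z * (g₂ * (1 - g₁)) = ν 1 := by rw [hz]; exact div_mul_cancel₀ _ hden.ne'
  have hd0 : 0 < 1 - m / M := by
    rw [sub_pos, div_lt_one hMpos]; exact hmM
  set a : ℝ := (ν 0 - z * ((1 - g₁) * (1 - g₂))) / (1 - m / M) with ha
  have haid : a * (1 - m / M) = ν 0 - z * ((1 - g₁) * (1 - g₂)) := by rw [ha]; exact div_mul_cancel₀ _ hd0.ne'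
  have ha0 : 0 ≤ a := by
    refine div_nonneg ?_ hd0.le
    have : z * ((1 - g₁) * (1 - g₂)) * g₂ ≤ ν 0 * g₂ := by
      have e : z * ((1 - g₁) * (1 - g₂)) * g₂ = z * (g₂ * (1 - g₁)) * (1 - g₂) := by ring
      rw [e, hzid]; exact C1
    exact sub_nonneg.2 (le_of_mul_le_mul_right this hg₂0)
  -- the two blob components, pointwise
  set A : ℕ → ℝ := blobLaw [(M, m / M)] with hAdef
  set Z : ℕ → ℝ := blobLaw [(M - 1, g₁), (1, g₂)] with hZdef
  have Aap : ∀ h : ℕ, A h = (if h = 0 then 1 - m / M else 0) + (if h = M then m / M else 0) := fun h => by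
    rw [hAdef, blobLaw_single_apply]
  have inner : ∀ k : ℕ, blobLaw [(1, g₂)] k = (if k = 0 then 1 - g₂ else 0) + (if k = 1 then g₂ else 0) := fun k => blobLaw_single_apply 1 g₂ k
  have Zsl : ∀ h : ℕ, Z h = (1 - g₁) * blobLaw [(1, g₂)] h + g₁ * (if M - 1 ≤ h then blobLaw [(1, g₂)] (h - (M - 1)) else 0) := fun h => rfl
  have A0 : A 0 = 1 - m / M := by rw [Aap, if_pos rfl, if_neg (by omega), add_zero]
  have A1 : A 1 = 0 := by rw [Aap, if_neg (by omega), if_neg (by omega), add_zero]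
  have AM1 : A (M - 1) = 0 := by rw [Aap, if_neg (by omega), if_neg (by omega), add_zero]
  have AM : A M = m / M := by rw [Aap, if_neg (by omega), if_pos rfl, zero_add]
  have Aoth : ∀ h, h ≠ 0 → h ≠ M → A h = 0 := fun h h0 hM' => by rw [Aap, if_neg h0, if_neg hM', add_zero]
  have Z0 : Z 0 = (1 - g₁) * (1 - g₂) := by
    rw [Zsl, if_neg (by omega), inner, if_pos rfl, if_neg (by omega)]; ring
  have Z1 : Z 1 = (1 - g₁) * g₂ := by
    rw [Zsl, if_neg (by omega), inner, if_neg (by omega), if_pos rfl]; ring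
  have ZM1 : Z (M - 1) = g₁ * (1 - g₂) := by
    rw [Zsl, if_pos le_rfl, Nat.sub_self, inner, inner, if_neg (by omega), if_neg (by omega), if_pos rfl, if_neg (by omega)]; ring
  have ZM : Z M = g₁ * g₂ := by
    rw [Zsl, if_pos (by omega), show M - (M - 1) = 1 by omega, inner, inner, if_neg (by omega), if_neg (by omega), if_neg (by omega),
      if_pos rfl]; ring
  have Zoth : ∀ h, h ≠ 0 → h ≠ 1 → h ≠ M - 1 → h ≠ M → Z h = 0 := fun h h0 h1 h2 h3 => by
    rw [Zsl, inner, if_neg h0, if_neg h1]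
    by_cases hle : M - 1 ≤ h
    · rw [if_pos hle, inner, if_neg (by omega), if_neg (by omega)]; ring
    · rw [if_neg hle]; ring
  -- masses and means of the components
  have hAsum : ∑ h ∈ Finset.range (M + 1), A h = 1 := by rw [hAdef]; exact sum_blobLaw_of_le _ (by simp [blobTop])
  have hAmean : ∑ h ∈ Finset.range (M + 1), (h : ℝ) * A h = m := by
    rw [hAdef, sum_mul_blobLaw_of_le _ (by simp [blobTop])]; simp [blobMean]; field_simp
  have hZtop : blobTop [(M - 1, g₁), (1, g₂)] = M := by simp [blobTop]; omega
  have hZsum : ∑ h ∈ Finset.range (M + 1), Z h = 1 := by rw [hZdef]; exact sum_blobLaw_of_le _ (by rw [hZtop])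
  have hZmean : ∑ h ∈ Finset.range (M + 1), (h : ℝ) * Z h = m := by
    rw [hZdef, sum_mul_blobLaw_of_le _ (by rw [hZtop])]; simp only [blobMean]; push_cast; rw [hcast]; linarith
  -- the remainder
  set R : ℕ → ℝ := fun h => ν h - a * A h - z * Z h with hRdef
  have R0 : R 0 = 0 := by simp only [hRdef]; rw [A0, Z0]; linear_combination (-1 : ℝ) * haid
  have R1 : R 1 = 0 := by simp only [hRdef]; rw [A1, Z1]; linear_combination (-1 : ℝ) * hzid
  have RM1 : R (M - 1) = ν (M - 1) - z * (g₁ * (1 - g₂)) := by simp only [hRdef]; rw [AM1, ZM1]; ring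
  have RM : R M = ν M - a * (m / M) - z * (g₁ * g₂) := by simp only [hRdef]; rw [AM, ZM]
  have Roth : ∀ h, h ≠ 0 → h ≠ 1 → h ≠ M - 1 → h ≠ M → R h = ν h := fun h h0 h1 h2 h3 => by
    simp only [hRdef]; rw [Aoth h h0 h3, Zoth h h0 h1 h2 h3]; ring
  have hRM1 : 0 ≤ R (M - 1) := by
    rw [RM1]
    have : z * (g₁ * (1 - g₂)) * (g₂ * (1 - g₁)) ≤ ν (M - 1) * (g₂ * (1 - g₁)) := by
      have e : z * (g₁ * (1 - g₂)) * (g₂ * (1 - g₁)) = z * (g₂ * (1 - g₁)) * g₁ * (1 - g₂) := by ring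
      rw [e, hzid]; linarith [C3]
    exact sub_nonneg.2 (le_of_mul_le_mul_right this hden)
  have hRM : 0 ≤ R M := by
    rw [RM]
    -- C4 divided by `(M − m)·g₂(1−g₁) > 0`, with `a(1 − m/M) = ν0 − z(1−g₁)(1−g₂)` and `z·g₂(1−g₁) = ν1`
    have hMm : 0 < (M : ℝ) - m := by linarith
    have key : (a * (m / M) + z * (g₁ * g₂)) * (((M : ℝ) - m) * (g₂ * (1 - g₁))) ≤ ν M * (((M : ℝ) - m) * (g₂ * (1 - g₁))) := by
      have e1 : a * (m / M) * (((M : ℝ) - m) * (g₂ * (1 - g₁))) = (a * (1 - m / M)) * m * (g₂ * (1 - g₁)) := by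
        field_simp
      have e2 : z * (g₁ * g₂) * (((M : ℝ) - m) * (g₂ * (1 - g₁))) = (z * (g₂ * (1 - g₁))) * g₁ * g₂ * ((M : ℝ) - m) := by ring
      rw [add_mul, e1, e2, haid, hzid]
      have e3 : (ν 0 - z * ((1 - g₁) * (1 - g₂))) * m * (g₂ * (1 - g₁))
          = (ν 0 * g₂ * (1 - g₁) - (z * (g₂ * (1 - g₁))) * (1 - g₁) * (1 - g₂)) * m := by ring
      rw [e3, hzid]
      linarith [C4]
    have := le_of_mul_le_mul_right key (mul_pos hMm hden)
    linarith
  have hRnn : ∀ h, 0 ≤ R h := by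
    intro h
    by_cases h0 : h = 0
    · rw [h0, R0]
    by_cases h1 : h = 1
    · rw [h1, R1]
    by_cases h2 : h = M - 1
    · rw [h2]; exact hRM1
    by_cases h3 : h = M
    · rw [h3]; exact hRM
    rw [Roth h h0 h1 h2 h3]; exact hν0 h
  have hRtop : ∀ h, M < h → R h = 0 := fun h hh => by
    rw [Roth h (by omega) (by omega) (by omega) (by omega)]; exact hνM h hh
  set w : ℝ := 1 - a - z with hw
  have hRsum : ∑ h ∈ Finset.range (M + 1), R h = w := by
    simp only [hRdef]
    rw [Finset.sum_sub_distrib, Finset.sum_sub_distrib, hν1, ← Finset.mul_sum, ← Finset.mul_sum, hAsum, hZsum, hw]; ring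
  have hRmean : ∑ h ∈ Finset.range (M + 1), (h : ℝ) * R h = m * w := by
    have e : ∀ h : ℕ, (h : ℝ) * R h = (h : ℝ) * ν h - a * ((h : ℝ) * A h) - z * ((h : ℝ) * Z h) := fun h => by simp only [hRdef]; ring
    rw [Finset.sum_congr rfl fun h _ => e h, Finset.sum_sub_distrib, Finset.sum_sub_distrib, hmean, ← Finset.mul_sum, ← Finset.mul_sum,
      hAmean, hZmean, hw]; ring
  have hw0 : 0 ≤ w := by rw [← hRsum]; exact Finset.sum_nonneg fun h _ => hRnn h
  have k : ∀ h, w * (R h / w) = R h := by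
    intro h
    by_cases hwz : w = 0
    · have hz' : R h = 0 := by
        by_cases hh : h ∈ Finset.range (M + 1)
        · have := (Finset.sum_eq_zero_iff_of_nonneg fun j _ => hRnn j).1 (by rw [hRsum, hwz]) h hh; exact this
        · exact hRtop h (by rw [Finset.mem_range] at hh; omega)
      rw [hz', hwz]; simp
    · field_simp
  -- the components are members
  have hA : HullHigh x m M A := by
    have e : blobMean [(M, m / M)] = m := by simp [blobMean]; field_simp
    have key := hullHigh_blobLaw x [(M, m / M)] (fun p hp => by
      rw [List.mem_singleton] at hp; subst hp
      refine ⟨?_, ?_⟩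
      · show x ≤ m / M
        rw [le_div_iff₀ hMpos]; exact hxM
      · show m / M ≤ 1
        rw [div_le_one hMpos]; exact hmM.le) (M := M) (by simp [blobTop])
    rwa [e] at key
  have hZ : HullHigh x m M Z := by
    have e : blobMean [(M - 1, g₁), (1, g₂)] = m := by simp only [blobMean]; push_cast; rw [hcast]; linarith
    have key := hullHigh_blobLaw x [(M - 1, g₁), (1, g₂)] (fun p hp => by
      simp only [List.mem_cons, List.mem_nil_iff, or_false] at hp
      rcases hp with hp | hp <;> subst hp
      · exact ⟨hxg₁, hg₁1.le⟩
      · exact ⟨hxg₂, hg₂1⟩) (M := M) (by rw [hZtop])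
    rwa [e] at key
  have hH : 0 < w → HullHigh x m M (fun h => R h / w) := by
    intro hwpos
    refine hullHigh_of_isHigh ⟨fun h => div_nonneg (hRnn h) hwpos.le, fun h hh => by show R h / w = 0; rw [hRtop h hh, zero_div],
      by rw [← Finset.sum_div, hRsum, div_self hwpos.ne'], ?_, fun h hpos => ?_, hxM⟩
    · have e : ∀ h : ℕ, (h : ℝ) * (R h / w) = ((h : ℝ) * R h) / w := fun h => by ring
      rw [Finset.sum_congr rfl fun h _ => e h, ← Finset.sum_div, hRmean, mul_div_assoc, div_self hwpos.ne', mul_one]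
    · have hRh : 0 < R h := by
        rcases div_pos_iff.1 hpos with ⟨h1, _⟩ | ⟨_, h2⟩
        · exact h1
        · exact absurd h2 (not_lt.2 hwpos.le)
      have h0 : h ≠ 0 := by rintro rfl; rw [R0] at hRh; exact lt_irrefl _ hRh
      have h1 : h ≠ 1 := by rintro rfl; rw [R1] at hRh; exact lt_irrefl _ hRh
      by_cases h2 : h = M - 1
      · rw [h2, hcast]; linarith
      by_cases h3 : h = M
      · rw [h3]; linarith
      rw [Roth h h0 h1 h2 h3] at hRh
      exact hhigh2 h hRh (by omega)
  -- assemble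
  refine HullHigh.mix₃ (a := a) (b := z) (c := w) (α := A) (β := Z) (γ := fun h => R h / w) (fun h => ?_) ha0 hz0 hw0 (by rw [hw]; ring)
    (fun _ => hA) (fun _ => hZ) hH
  rw [k h]; simp only [hRdef]; ring

/-- **THE SIBLING FORM**: a law-OK gated sibling `gate s.ρ s.q` with `s.q·s.mean ≤ 4`, `s.q·s.mean < s.M`, `3 ≤ s.M`, and gates/conditions as in
`hullHigh_lowOne` for the gated law `ν = gate s.ρ s.q` (`ν 0 = 1 − s.q + s.q ρ 0`, `ν h = s.q ρ h`), is hull+high decomposable at `x`. [this work] -/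
theorem hullHigh_gate_lowOne {x g₁ g₂ : ℝ} (s : Sib) (hs : s.LawOK) (hM : 3 ≤ s.M) (hm4 : s.q * s.mean ≤ 4)
    (hmM : s.q * s.mean < s.M) (hg : ((s.M : ℝ) - 1) * g₁ + g₂ = s.q * s.mean)
    (hxg₂ : x ≤ g₂) (hg₂0 : 0 < g₂) (hg₂1 : g₂ ≤ 1) (hxg₁ : x ≤ g₁) (hg₁1 : g₁ < 1)
    (C1 : gate s.ρ s.q 1 * (1 - g₂) ≤ gate s.ρ s.q 0 * g₂)
    (C3 : gate s.ρ s.q 1 * g₁ * (1 - g₂) ≤ gate s.ρ s.q (s.M - 1) * g₂ * (1 - g₁))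
    (C4 : (gate s.ρ s.q 0 * g₂ * (1 - g₁) - gate s.ρ s.q 1 * (1 - g₁) * (1 - g₂)) * (s.q * s.mean)
      + gate s.ρ s.q 1 * g₁ * g₂ * ((s.M : ℝ) - s.q * s.mean) ≤ gate s.ρ s.q s.M * ((s.M : ℝ) - s.q * s.mean) * g₂ * (1 - g₁)) :
    HullHigh x (s.q * s.mean) s.M (gate s.ρ s.q) := by
  obtain ⟨hq0, hq1, ρ0, ρM, ρ1⟩ := hs
  obtain ⟨g0, gM, g1⟩ := gate_laws s.M s.ρ s.q hq0.le hq1.le ρ0 ρM ρ1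
  have gmean : ∑ h ∈ Finset.range (s.M + 1), (h : ℝ) * gate s.ρ s.q h = s.q * s.mean := by rw [sum_mul_gate]; rfl
  refine hullHigh_lowOne x (s.q * s.mean) g₁ g₂ s.M hM (gate s.ρ s.q) g0 gM g1 gmean hmM (fun h _ hh => ?_) hg hxg₂ hg₂0 hg₂1 hxg₁ hg₁1
    C1 C3 C4
  have : (2 : ℝ) ≤ h := by exact_mod_cast hh
  linarith

end LawDec
end Quant
end Summit.CriticalPhenomena.PercolationContinuityZ3.Theorems
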